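import Summits.ResolutionOfSingularities.ResolutionOfSingularities.Theorems.EquisingularLiftEquisingularLiftNatTowerBQuadPrimeAssemblyFull
import Summits.ResolutionOfSingularities.ResolutionOfSingularities.Theorems.EquisingularLiftEquisingularLiftNatNDStrataTower
import Summits.ResolutionOfSingularities.ResolutionOfSingularities.Theorems.EquisingularLiftEquisingularLiftNatCarrierDeltaComapFrame
import Summits.ResolutionOfSingularities.ResolutionOfSingularities.Theorems.EquisingularLiftEquisingularLiftCentreBlowupSmooth
import Summits.ResolutionOfSingularities.ResolutionOfSingularities.Theorems.EquisingularLiftEquisingularLiftSectionOfSmooth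
import Summits.ResolutionOfSingularities.ResolutionOfSingularities.Theorems.EquisingularLiftEquisingularLiftNatSectionStep
import Summits.ResolutionOfSingularities.ResolutionOfSingularities.Theorems.EquisingularLiftEquisingularLiftNatPlaneCurveSingular
import Literature.AlgebraicGeometry.Resolution.BlowupsFlatBaseChange
import Literature.AlgebraicGeometry.Resolution.BlowupsProperProofs
import Mathlib.AlgebraicGeometry.AlgClosed.Basic
import HarnessLib

/-!
# [OURS · L1 W4.5(b) · EL♮(3) · K6 «ND-LEAVES»] THE LEAF POINT PACKAGE: the O-side socket at an A⁗-prefix end and K5′'s point-step inputs at a leaf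

WIDTH support for res-L1-w45b-idea-1's SPEC K6 (`Cruxes/EquisingularLiftNatThree/NDLeavesRungK6.lean`; desk R33 (β) / DEALS NOW 2026-08-28 l.82018),
`--supports stmt-ResolutionOfSingularities-20148`, no claim, counted 0 (res-L1-w45b-stub-4 g11, ENGINE-END WORD v1 §7 (S1)/(S4)/(S5)).  AI-produced kernel
work weaker than expert review; no statement of [Hironaka2017] is used; EL♮(3) is NOT proved here.

WHAT.
* (S1) `ND.stageTuple_of_engineEnd` — the conclusion shape of the A-engine suppliers (V10″ p621407 / V10⁗-full p631707 / V10⁵-full ✓ p635361) at a reach end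
  IS res-L1-w45b-lead-2's `ND.StageTuple` (✓ p638808) up to the order of conjuncts; `ND.stageTuple_of_reachTowerBQuadPrime` — V10⁵-full composed with it (all
  engine binders verbatim).
* `ND.isProper_and_isLocallyNoetherian_of_chain` — along a `Split.Chain` the structure morphism is proper and the stage locally Noetherian.
* `ND.goodAt_and_dim_of_model` — in a model square over a DVR (`θ : O ↠ k`, `X` integral and flat over `O`), at a point `x` of the special fibre `F` with
  `𝒪_{X,jm x}` and `𝒪_{F,x}` regular: good reduction `GoodAt (σ ≫ q) (jm x)` and `dim 𝒪_{X,jm x} = dim 𝒪_{F,x} + 1` (the kernel of `jm♯_x` is the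
  uniformizer's germ: lead-2/027's `stalkMap_model_*`; Matsumura 14.2 via `not_mem_sq_of_isRegularLocalRing_quotient` / `quotient_span_singleton`).
* `ND.exists_residueField_equiv` — `O/𝔪 ≃ k` compatibly with `θ`.
* ★ `ND.leafPointPackage` — at an `ND.StageTuple` stage (O complete, `k = k̄`, `q` proper, `Ch ⇒ Chain`), a CLOSED point `x ∈ F` with `𝒪_{F,x}` regular of
  dimension `n` and `σ (jm x)` not the generic point of `Y` yields K5′'s point-step input list `(U hU s hs hsU hsx hdim hxreg hsoff)`: a neighbourhood `U ∋ jm x`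
  SMOOTH over `Spec O` (route `exists_smooth_nhd_of_goodAt`), an `O`-SECTION through `jm x` (route `exists_section_of_smooth`, Hensel, via Mathlib
  `pointOfClosedPoint`), `dim 𝒪_{X,jm x} = n+1`, and `hsoff` (route `image_support_ker_subset_not_isGenericPoint`) — the (N1b)+(N1c) adapters of the desk's
  ruling: NO new mathematics, only plumbing over existing decls.
-/

set_option linter.dupNamespace false
set_option linter.overlappingInstances false

noncomputable section

open CategoryTheory CategoryTheory.Limits AlgebraicGeometry TopologicalSpace Topology IsLocalRing
open Literature.AlgebraicGeometry.Resolution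
open AlgebraicGeometry.Scheme.IdealSheafData
open Summit.ResolutionOfSingularities.ResolutionOfSingularities.Theses.EquisingularLift.Split
open Summit.ResolutionOfSingularities.ResolutionOfSingularities.Cruxes.EquisingularLift.StrataSplit

namespace Summit.ResolutionOfSingularities.ResolutionOfSingularities.Cruxes.EquisingularLiftNat.Sections

/-! ## §1 The O-side socket: an engine end IS an `ND.StageTuple` -/

/-- **The O-side socket.**  The conclusion shape of V10⁵-full (`hsub_reachTowerBQuadPrime_of_fact_full` ✓ p635361; verbatim the same for V10⁗-full p631707 /
V10″ p621407) at a reach end `(F', T')` is res-L1-w45b-lead-2's `ND.StageTuple` (✓ p638808) up to the order of conjuncts. [OURS · pure logic] -/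
theorem ND.stageTuple_of_engineEnd (O : Type) [CommRing O] (k : Type) [Field k] (θ : O →+* k)
    (P : Scheme.{0}) (q : P ⟶ Spec (.of O)) (Ch : ∀ X' : Scheme.{0}, (X' ⟶ P) → Set X' → Prop)
    {F' : Scheme.{0}} {T' : Set F'}
    (h : ∃ (X₉ : Scheme.{0}) (σ₉ : X₉ ⟶ P) (S₉ : Set X₉) (j₉ : F' ⟶ X₉) (t₉ : F' ⟶ Spec (.of k)),
        Ch X₉ σ₉ S₉ ∧ IsIntegral X₉ ∧ IsLocallyNoetherian X₉ ∧ Scheme.IsRegular X₉ ∧ IsDominant (σ₉ ≫ q) ∧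
        IsPullback j₉ t₉ (σ₉ ≫ q) (Spec.map (CommRingCat.ofHom θ)) ∧ j₉ '' T' = S₉ ∧ IsClosed T' ∧ IsIrreducible T' ∧ IsIntegral F') :
    ∃ (X₉ : Scheme.{0}) (σ₉ : X₉ ⟶ P) (S₉ : Set X₉) (j₉ : F' ⟶ X₉) (t₉ : F' ⟶ Spec (.of k)),
      ND.StageTuple O k θ P q Ch X₉ σ₉ S₉ F' j₉ t₉ T' := by
  obtain ⟨X₉, σ₉, S₉, j₉, t₉, hCh, hXi, hXn, hXr, hdom, hsq, himg, hcl, hirr, hFi⟩ := h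
  exact ⟨X₉, σ₉, S₉, j₉, t₉, hCh, hXi, hXn, hXr, hdom, hFi, hsq, himg, hcl, hirr⟩

/-- **The O-side socket, instantiated**: V10⁵-full composed with the adapter — every `ReachTowerBQuadPrime` end of an A⁗-prefix carries an
`ND.StageTuple` (all engine binders as in p635361). [OURS · pure logic over ✓ p635361] -/
theorem ND.stageTuple_of_reachTowerBQuadPrime (k : Type) [Field k] [IsAlgClosed k]
    (O : Type) [CommRing O] [IsDomain O] [IsDiscreteValuationRing O] [IsAdicComplete (IsLocalRing.maximalIdeal O) O]
    [IsAlgClosed (IsLocalRing.ResidueField O)] (θ : O →+* k) (hθ : Function.Surjective θ)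
    (P : Scheme.{0}) (q : P ⟶ Spec (.of O)) (Y : Set P) (Ch : ∀ X' : Scheme.{0}, (X' ⟶ P) → Set X' → Prop)
    (hChStep : ∀ (X' X'' : Scheme.{0}) (σ' : X' ⟶ P) (S' : Set X') (C : X'.IdealSheafData) (τ : X'' ⟶ X'),
      Ch X' σ' S' → IsBlowup τ C → Scheme.IsRegular C.subscheme → Flat (C.subschemeι ≫ σ' ≫ q) →
      σ' '' (C.support : Set X') ⊆ {y | ¬ IsGenericPoint y Y} → (C.support : Set X') ∩ (σ' ≫ q) ⁻¹' {IsLocalRing.closedPoint O} ⊆ S' →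
      Ch X'' (τ ≫ σ') (closure (τ ⁻¹' (S' \ (C.support : Set X')))))
    (hChSplit : ∀ (X' : Scheme.{0}) (σ' : X' ⟶ P) (S' : Set X'), Ch X' σ' S' → Chain P Y X' σ' S')
    (hYsp : Y ⊆ q ⁻¹' {IsLocalRing.closedPoint O}) (hYirr : IsIrreducible Y) (hYcl : IsClosed Y) (hPint : IsIntegral P)
    (hPnoeth : IsLocallyNoetherian P) (hPreg : Scheme.IsRegular P) (hqprop : IsProper q) (hqsm : SmoothOfRelativeDimension 3 q)
    (X' : Scheme.{0}) (σ' : X' ⟶ P) (S' : Set X') (hCh' : Ch X' σ' S') (hX'int : IsIntegral X') (hX'noeth : IsLocallyNoetherian X')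
    (hX'reg : Scheme.IsRegular X') (hX'dom : IsDominant (σ' ≫ q)) (F₁ : Scheme.{0}) (hF₁ : IsIntegral F₁) (j : F₁ ⟶ X')
    (t : F₁ ⟶ Spec (.of k)) (hsq : IsPullback j t (σ' ≫ q) (Spec.map (CommRingCat.ofHom θ))) (T₁ : Set F₁) (hT₁cl : IsClosed T₁)
    (hT₁irr : IsIrreducible T₁) (hjT₁ : j '' T₁ = S') (x : F₁) (hx : IsClosed ({x} : Set F₁)) (U : X'.Opens)
    (hU : Smooth (U.ι ≫ σ' ≫ q)) (s : Spec (.of O) ⟶ X') (hs : s ≫ σ' ≫ q = 𝟙 _) (hsU : s (IsLocalRing.closedPoint O) ∈ U)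
    (hsx : s (IsLocalRing.closedPoint O) = j x)
    (hdim : ringKrullDim (X'.presheaf.stalk (s (IsLocalRing.closedPoint O))) = ((3 + 1 : ℕ) : WithBot ℕ∞))
    (hxreg : IsRegularLocalRing (F₁.presheaf.stalk x)) (hsoff : ∀ c ∈ (s.ker.support : Set X'), ¬ IsGenericPoint (σ' c) Y)
    (X₁ : Scheme.{0}) (τ₁ : X₁ ⟶ X') (hτ₁ : IsBlowup τ₁ s.ker) (hX₁int : IsIntegral X₁) (hX₁noeth : IsLocallyNoetherian X₁)
    (hX₁reg : Scheme.IsRegular X₁) (hX₁dom : IsDominant ((τ₁ ≫ σ') ≫ q)) (F₂ : Scheme.{0}) (hF₂ : IsIntegral F₂) (υ : F₂ ⟶ F₁)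
    (hυ : IsBlowup υ (Scheme.IdealSheafData.vanishingIdeal (⟨{x}, hx⟩ : Closeds F₁))) (j₂ : F₂ ⟶ X₁) (t₂ : F₂ ⟶ Spec (.of k))
    (hsq₂ : IsPullback j₂ t₂ ((τ₁ ≫ σ') ≫ q) (Spec.map (CommRingCat.ofHom θ))) (hcomm : j₂ ≫ τ₁ = υ ≫ j)
    (hcarrier : (s.ker.comap τ₁).comap j₂ = (Scheme.IdealSheafData.vanishingIdeal (⟨{x}, hx⟩ : Closeds F₁)).comap υ)
    (hirr₂ : IsIrreducible (closure (υ ⁻¹' (T₁ \ {x})))) (hCh₁ : Ch X₁ (τ₁ ≫ σ') (j₂ '' closure (υ ⁻¹' (T₁ \ {x}))))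
    (Ls₂ : List (Set F₂)) (hLs₂ : ∀ L ∈ Ls₂, IsClosed L ∧ ¬ closure (υ ⁻¹' (T₁ \ {x})) ⊆ L)
    (hFact : EmbeddedCurveLift O k θ P q)
    (hBaseSL : ∀ W : Set F₁, x ∈ W → ¬ (υ ⁻¹' {x} ⊆ closure (υ ⁻¹' (W \ {x}))) →
        (∃ U₁ : F₁.affineOpens, x ∈ (U₁ : F₁.Opens) ∧
          ((Scheme.IdealSheafData.vanishingIdeal (⟨closure W, isClosed_closure⟩ : Closeds F₁)).ideal U₁).IsPrincipal) →
        ConeForm F₁ x W →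
        TCPlus.InvSL O k θ P q Y Ch W F₂ (𝟙 F₂) (closure (υ ⁻¹' (T₁ \ {x}))) (υ ⁻¹' {x} ∩ closure (υ ⁻¹' (W \ {x})))
          (closure (υ ⁻¹' (W \ {x}))) (υ ⁻¹' {x}) Ls₂ false)
    (hBaseS₀L : ∀ W : Set F₁, x ∈ W → ¬ (υ ⁻¹' {x} ⊆ closure (υ ⁻¹' (W \ {x}))) →
        (∃ U₁ : F₁.affineOpens, x ∈ (U₁ : F₁.Opens) ∧
          ((Scheme.IdealSheafData.vanishingIdeal (⟨closure W, isClosed_closure⟩ : Closeds F₁)).ideal U₁).IsPrincipal) →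
        TCPlus.InvS₀L O k θ P q Y Ch W F₂ (𝟙 F₂) (closure (υ ⁻¹' (T₁ \ {x}))) (υ ⁻¹' {x} ∩ closure (υ ⁻¹' (W \ {x}))) (υ ⁻¹' {x})
          Ls₂ false)
    (F' : Scheme.{0}) (β : F' ⟶ F₂) (T' : Set F') (hR : ReachTowerBQuadPrime F₁ F₂ υ x (closure (υ ⁻¹' (T₁ \ {x}))) Ls₂ F' β T') :
    ∃ (X₉ : Scheme.{0}) (σ₉ : X₉ ⟶ P) (S₉ : Set X₉) (j₉ : F' ⟶ X₉) (t₉ : F' ⟶ Spec (.of k)),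
      ND.StageTuple O k θ P q Ch X₉ σ₉ S₉ F' j₉ t₉ T' :=
  ND.stageTuple_of_engineEnd O k θ P q Ch
    (hsub_reachTowerBQuadPrime_of_fact_full k O θ hθ P q Y Ch hChStep hChSplit hYsp hYirr hYcl hPint hPnoeth hPreg hqprop hqsm X' σ' S' hCh'
      hX'int hX'noeth hX'reg hX'dom F₁ hF₁ j t hsq T₁ hT₁cl hT₁irr hjT₁ x hx U hU s hs hsU hsx hdim hxreg hsoff X₁ τ₁ hτ₁ hX₁int hX₁noeth
      hX₁reg hX₁dom F₂ hF₂ υ hυ j₂ t₂ hsq₂ hcomm hcarrier hirr₂ hCh₁ Ls₂ hLs₂ hFact hBaseSL hBaseS₀L F' β T' hR)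

/-! ## §2 A `Chain` stage is proper and locally Noetherian -/

/-- Along a `Split.Chain` over a locally Noetherian base the structure morphism is proper and the stage is locally Noetherian (each step is a blow-up of a
locally Noetherian scheme: `IsBlowup.isProper`, `IsBlowup.isLocallyNoetherian`). [OURS · induction over `Chain`] -/
theorem ND.isProper_and_isLocallyNoetherian_of_chain {P : Scheme.{0}} [IsLocallyNoetherian P] {Y : Set P} {X : Scheme.{0}} {σ : X ⟶ P} {S : Set X}
    (h : Chain P Y X σ S) : IsProper σ ∧ IsLocallyNoetherian X := by
  refine h (fun X' σ' _ => IsProper σ' ∧ IsLocallyNoetherian X') ⟨inferInstance, inferInstance⟩ ?_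
  intro X' X'' σ' Y' C τ hQ hτ _ _
  obtain ⟨hσ', hX'⟩ := hQ
  haveI := hσ'; haveI := hX'
  haveI : IsProper τ := hτ.isProper
  exact ⟨inferInstance, hτ.isLocallyNoetherian⟩

/-! ## §3 Good reduction at a point where the special fibre is regular -/

/-- **Good reduction from the special fibre.**  In a model square `jm ≫ r = t ≫ Spec θ` (`θ : O ↠ k`, `O` a DVR) over an integral `X` flat over `O`, at a point
`x` of the special fibre `F` where BOTH `𝒪_{X, jm x}` and `𝒪_{F, x}` are regular: the germ of a uniformizer is outside `𝔪²_{jm x}` (`GoodAt`), and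
`dim 𝒪_{X, jm x} = dim 𝒪_{F, x} + 1`.  (The kernel of `jm♯_x : 𝒪_{X,jm x} ↠ 𝒪_{F,x}` is the ideal of the uniformizer's germ, res-L1-w45b-lead-2/027's model
lemmas `stalkMap_model_surjective` / `stalkMap_model_varpi` / `ker_stalkMap_model_le`; then Matsumura 14.2.) [OURS · adapter] -/
theorem ND.goodAt_and_dim_of_model (O : Type) [CommRing O] [IsDomain O] [IsDiscreteValuationRing O] (k : Type) [Field k]
    (θ : O →+* k) (hθ : Function.Surjective θ) {X F : Scheme.{0}} [IsIntegral X] (r : X ⟶ Spec (.of O)) [Flat r]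
    (jm : F ⟶ X) (t : F ⟶ Spec (.of k)) (hsq : IsPullback jm t r (Spec.map (CommRingCat.ofHom θ))) (x : F)
    (hXreg : IsRegularLocalRing (X.presheaf.stalk (jm x))) (hFreg : IsRegularLocalRing (F.presheaf.stalk x)) :
    GoodAt r (jm x) ∧ ringKrullDim (X.presheaf.stalk (jm x)) = ringKrullDim (F.presheaf.stalk x) + 1 := by
  haveI := hXreg
  -- the germ of an element of `O` at `jm x`
  let gm : O → X.presheaf.stalk (jm x) := fun a => (X.presheaf.Γgerm (jm x)).hom (r.appTop.hom ((Scheme.ΓSpecIso (.of O)).inv.hom a))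
  -- (i) the germ of any `a ∈ 𝔪_O` is killed by `jm♯_x`, hence lies in the maximal ideal
  have hkill : ∀ a ∈ maximalIdeal O, (jm.stalkMap x).hom (gm a) = 0 := fun a ha => stalkMap_model_varpi θ hθ r jm t hsq x a ha
  have hmem : ∀ a ∈ maximalIdeal O, gm a ∈ maximalIdeal (X.presheaf.stalk (jm x)) := by
    intro a ha
    rw [IsLocalRing.mem_maximalIdeal]
    intro hu
    have h0 := hkill a ha
    have := hu.map (jm.stalkMap x).hom
    rw [h0] at this
    exact not_isUnit_zero this
  -- (ii) the germ of a non-zero element is non-zero (flatness ⇒ `r♯` injective on stalks; `Spec O` integral)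
  have hne : ∀ a : O, a ≠ 0 → gm a ≠ 0 := by
    intro a ha h0
    have hrx : r (jm x) = r (jm x) := rfl
    have hgerm : gm a = (r.stalkMap (jm x)).hom (((Spec (.of O)).presheaf.Γgerm (r (jm x))).hom ((Scheme.ΓSpecIso (.of O)).inv.hom a)) :=
      (stalkMap_Γgerm_apply' r (jm x) _).symm
    rw [hgerm] at h0
    have h1 := stalkMap_injective_of_flat r (jm x) (h0.trans (map_zero _).symm)
    have h2 : (Scheme.ΓSpecIso (.of O)).inv.hom a = 0 :=
      AlgebraicGeometry.germ_injective_of_isIntegral (X := Spec (.of O)) (U := ⊤) (r (jm x)) trivial (h1.trans (map_zero _).symm)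
    apply ha
    have := congrArg (Scheme.ΓSpecIso (.of O)).hom.hom h2
    rw [map_zero, ← CommRingCat.comp_apply, Iso.inv_hom_id] at this
    exact this
  -- a uniformizer and its germ `g`
  obtain ⟨ϖ, hϖ⟩ := IsDiscreteValuationRing.exists_irreducible O
  have hϖm : ϖ ∈ maximalIdeal O := (IsDiscreteValuationRing.irreducible_iff_uniformizer ϖ).mp hϖ ▸ Ideal.mem_span_singleton_self ϖ
  set g := gm ϖ with hg
  have hgm : g ∈ maximalIdeal (X.presheaf.stalk (jm x)) := hmem ϖ hϖm
  have hg0 : g ≠ 0 := hne ϖ hϖ.ne_zero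
  -- (iii) `𝒪_{X,jm x} / (g) ≅ 𝒪_{F,x}`
  have hker : RingHom.ker (jm.stalkMap x).hom = Ideal.span {g} := by
    refine le_antisymm (ker_stalkMap_model_le O k θ hθ r jm t hsq x ϖ hϖ) ?_
    rw [Ideal.span_le, Set.singleton_subset_iff]
    exact hkill ϖ hϖm
  let e : (X.presheaf.stalk (jm x) ⧸ Ideal.span {g}) ≃+* F.presheaf.stalk x :=
    (Ideal.quotEquivOfEq hker.symm).trans (RingHom.quotientKerEquivOfSurjective (stalkMap_model_surjective θ hθ r jm t hsq x))
  have hqreg : IsRegularLocalRing (X.presheaf.stalk (jm x) ⧸ Ideal.span {g}) :=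
    letI := hFreg; IsRegularLocalRing.of_ringEquiv e.symm
  -- (iv) `g ∉ 𝔪²` and the dimension
  have hg2 : g ∉ maximalIdeal (X.presheaf.stalk (jm x)) ^ 2 :=
    not_mem_sq_of_isRegularLocalRing_quotient hgm (IsRegular.of_ne_zero hg0).left.isSMulRegular hqreg
  refine ⟨⟨hXreg, ?_⟩, ?_⟩
  · intro ϖ' hϖ'
    have hassoc : Associated ϖ' ϖ := IsDiscreteValuationRing.associated_of_irreducible O hϖ' hϖ
    obtain ⟨u, hu⟩ := hassoc
    -- `gm ϖ' = gm ϖ * gm u` with `gm u` a unit: same membership in `𝔪²`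
    have hmul : gm ϖ = gm ϖ' * gm (u : O) := by
      simp only [gm, ← hu, map_mul]
    intro hmem2
    apply hg2
    rw [hg, hmul]
    exact Ideal.mul_mem_right _ _ hmem2
  · have hdim := (IsRegularLocalRing.quotient_span_singleton hgm hg2).2
    rw [← hdim, RingEquiv.ringKrullDim e]

/-! ## §4 The residue field of `O` is `k` -/

/-- For a surjection `θ : O ↠ k` from a local ring onto a field, `O/𝔪 ≃ k` compatibly with `θ`. [folklore] -/
theorem ND.exists_residueField_equiv (O : Type) [CommRing O] [IsLocalRing O] (k : Type) [Field k] (θ : O →+* k) (hθ : Function.Surjective θ) :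
    ∃ e : ResidueField O ≃+* k, ∀ a : O, e (residue O a) = θ a := by
  have hker : RingHom.ker θ = maximalIdeal O := IsLocalRing.eq_maximalIdeal (RingHom.ker_isMaximal_of_surjective θ hθ)
  refine ⟨(Ideal.quotEquivOfEq hker.symm).trans (RingHom.quotientKerEquivOfSurjective hθ), fun a => ?_⟩
  change RingHom.quotientKerEquivOfSurjective hθ (Ideal.quotEquivOfEq hker.symm (Ideal.Quotient.mk _ a)) = θ a
  rw [Ideal.quotEquivOfEq_mk, RingHom.quotientKerEquivOfSurjective_apply_mk]

/-! ## §5 K5′'s point-step package PRODUCED at a leaf -/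

/-- **The leaf point package.**  At an engine stage `ND.StageTuple O k θ P q Ch X σ S F jm t T` (O complete, `k = k̄`, `θ : O ↠ k`, `q` proper, `Ch ⇒ Chain`), a
CLOSED point `x` of the special fibre `F` at which `F` is regular of dimension `n` and which does not lie over the generic point of `Y` carries the whole
point-step input list of K5′ (`hsub_of_invariant`: `U hU s hs hsU hsx hdim hxreg hsoff`): a neighbourhood `U` of `jm x` in `X` SMOOTH over `Spec O`
(`exists_smooth_nhd_of_goodAt`, good reduction from `goodAt_and_dim_of_model`), an `O`-SECTION `s` through `jm x` (Hensel, `exists_section_of_smooth`, via the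
`k`-point of the closed point `x`, Mathlib `pointOfClosedPoint`), `dim 𝒪_{X, jm x} = n + 1`, and `σ(supp ker s)` off the generic point of `Y`
(`image_support_ker_subset_not_isGenericPoint`). [OURS · L1 W4.5b · K6 «ND-LEAVES» (N1b)+(N1c)] -/
theorem ND.leafPointPackage (O : Type) [CommRing O] [IsDomain O] [IsDiscreteValuationRing O] [IsAdicComplete (maximalIdeal O) O]
    (k : Type) [Field k] [IsAlgClosed k] (θ : O →+* k) (hθ : Function.Surjective θ)
    (P : Scheme.{0}) [IsLocallyNoetherian P] (q : P ⟶ Spec (.of O)) [IsProper q] (Y : Set P) (hYsp : Y ⊆ q ⁻¹' {closedPoint O})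
    (Ch : ∀ X' : Scheme.{0}, (X' ⟶ P) → Set X' → Prop)
    (hChSplit : ∀ (X' : Scheme.{0}) (σ' : X' ⟶ P) (S' : Set X'), Ch X' σ' S' → Chain P Y X' σ' S')
    {X : Scheme.{0}} {σ : X ⟶ P} {S : Set X} {F : Scheme.{0}} {jm : F ⟶ X} {t : F ⟶ Spec (.of k)} {T : Set F}
    (hst : ND.StageTuple O k θ P q Ch X σ S F jm t T)
    (x : F) (hx : IsClosed ({x} : Set F)) (hFreg : IsRegularLocalRing (F.presheaf.stalk x)) {n : ℕ}
    (hdimF : ringKrullDim (F.presheaf.stalk x) = (n : WithBot ℕ∞)) (hgen : ¬ IsGenericPoint (σ (jm x)) Y) :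
    ∃ (U : X.Opens) (s : Spec (.of O) ⟶ X), Smooth (U.ι ≫ σ ≫ q) ∧ s ≫ σ ≫ q = 𝟙 _ ∧ s (closedPoint O) ∈ U ∧ s (closedPoint O) = jm x ∧
      ringKrullDim (X.presheaf.stalk (s (closedPoint O))) = ((n + 1 : ℕ) : WithBot ℕ∞) ∧ IsRegularLocalRing (F.presheaf.stalk x) ∧
      ∀ c ∈ (s.ker.support : Set X), ¬ IsGenericPoint (σ c) Y := by
  obtain ⟨hCh, hXint, hXnoeth, hXreg, hdom, hFint, hsq, -, -, -⟩ := hst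
  haveI := hXint; haveI := hXnoeth; haveI := hdom
  -- the structure morphism `r = σ ≫ q`: proper (Chain), finitely presented, flat
  haveI : IsProper σ := (ND.isProper_and_isLocallyNoetherian_of_chain (hChSplit X σ S hCh)).1
  set r : X ⟶ Spec (.of O) := σ ≫ q with hr
  haveI : IsProper r := inferInstance
  haveI : LocallyOfFinitePresentation r := locallyOfFinitePresentation_of_isLocallyNoetherian' r
  haveI : Flat r := flat_of_isIntegral_of_isDominant r
  -- the residue field of `O` is `k = k̄`
  obtain ⟨e, he⟩ := ND.exists_residueField_equiv O k θ hθ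
  haveI : IsAlgClosed (ResidueField O) := IsAlgClosed.of_ringEquiv k _ e.symm
  -- `jm x` lies over the closed point
  have hrx : r (jm x) = closedPoint O := by
    have : jm x ∈ Set.range jm := ⟨x, rfl⟩
    rw [range_eq_preimage_of_isPullback hsq, range_specMap_of_surjective_of_field θ hθ] at this
    exact this
  -- good reduction and the dimension
  obtain ⟨hgood, hdimX⟩ := ND.goodAt_and_dim_of_model O k θ hθ r jm t hsq x (hXreg (jm x)) hFreg
  -- (N1b) a smooth neighbourhood
  obtain ⟨U, hxU, hU⟩ := exists_smooth_nhd_of_goodAt O X r inferInstance inferInstance (jm x) hrx hgood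
  -- the `κ(O)`-point of `X` at `jm x`
  haveI : LocallyOfFiniteType t := MorphismProperty.IsStableUnderBaseChange.of_isPullback (P := @LocallyOfFiniteType) hsq inferInstance
  let p : Spec (.of k) ⟶ F := pointOfClosedPoint t x hx
  let x₀ : Spec (.of (ResidueField O)) ⟶ X := Spec.map (CommRingCat.ofHom (e.symm : k →+* ResidueField O)) ≫ p ≫ jm
  have hx₀pt : ∀ a, x₀ a = jm x := by
    intro a
    change jm (p (Spec.map (CommRingCat.ofHom (e.symm : k →+* ResidueField O)) a)) = jm x
    rw [pointOfClosedPoint_apply]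
  have hx₀r : x₀ ≫ r = Spec.map (CommRingCat.ofHom (residue O)) := by
    have hw : jm ≫ r = t ≫ Spec.map (CommRingCat.ofHom θ) := hsq.w
    change (Spec.map _ ≫ p ≫ jm) ≫ r = _
    rw [Category.assoc, Category.assoc, hw, ← Category.assoc p t, pointOfClosedPoint_comp, Category.id_comp, ← Spec.map_comp, ← CommRingCat.ofHom_comp]
    congr 2
    refine RingHom.ext fun a => ?_
    change e.symm (θ a) = residue O a
    rw [← he a, RingEquiv.symm_apply_apply]
  have hrange : Set.range x₀ ⊆ (U : Set X) := by
    rintro _ ⟨a, rfl⟩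
    rw [hx₀pt a]; exact hxU
  -- (N1c) the Hensel section
  obtain ⟨s, hs, hsx₀⟩ := exists_section_of_smooth O X r U hU x₀ hrange hx₀r
  have hspt : s (closedPoint O) = jm x := by
    have h1 : (Spec.map (CommRingCat.ofHom (residue O))) (closedPoint (ResidueField O)) = closedPoint O :=
      IsLocalRing.comap_closedPoint (residue O)
    rw [← h1]
    change (Spec.map (CommRingCat.ofHom (residue O)) ≫ s) (closedPoint (ResidueField O)) = jm x
    rw [hsx₀]; exact hx₀pt _
  refine ⟨U, s, hU, hs, hspt ▸ hxU, hspt, ?_, hFreg, ?_⟩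
  · rw [hspt, hdimX, hdimF]; rfl
  · intro c hc
    exact image_support_ker_subset_not_isGenericPoint O σ q Y hYsp s hs (hspt.symm ▸ hgen) ⟨c, hc, rfl⟩

end Summit.ResolutionOfSingularities.ResolutionOfSingularities.Cruxes.EquisingularLiftNat.Sections

end
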